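import Summits.RiemannHypothesis.RiemannHypothesis.Theorems.WeilColumnThetaPrimeSideT2
import Summits.RiemannHypothesis.RiemannHypothesis.Theorems.WeilColumnPrimeTermMollLimit
import HarnessLib

/-!
# THETA certificate, tier 2 — D6′ WITHOUT `IsWeilTest`: the cellwise prime side for a merely compactly supported odd tail (RH-FREE)

Cell `rh-explicit`, WEIL column, seat cc-s2-3 gen23 (TIER2-SOUNDNESS-PLAN v1.1 §2 E4/E5·E6 / §6; TIER2-KERNEL-SPEC §5 (K4)). weil-1's D6′
`ThetaPrime.norm_weilPrimeTerm_le_of_oddTail_cell` (`WeilColumnThetaPrimeSideT2`) takes `hgt : IsWeilTest g` and uses it ONLY for the support of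
`k = g ⋆ g̃`. In the tier-2 assembly (`WeilColumnThetaUCT2.ucT2_of_bounds`, hypothesis `hprime`) the bound is needed for the UNMOLLIFIED truncated
tail `g = P.TROdd R`, which is `C^{m−2}`, not `C^∞`. This file gives the twin **`norm_weilPrimeTerm_le_of_oddTail_cell_of_radius`** with `hgt`
replaced by `hga : ∀ u, a < |u| → g u = 0` (the support of `k` then comes from `weilConv_weilReflect_eq_zero_of_radius`, no smoothness); the
proof is weil-1's verbatim after that first step. Upper-clause bookkeeping only; nothing here bears on the truth of RH.
-/

noncomputable section

set_option linter.dupNamespace false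

open Complex Set MeasureTheory Filter
open scoped Real Topology ComplexConjugate

namespace Summit.RiemannHypothesis.RiemannHypothesis.Theorems.WeilColumn.ThetaPrime

open Literature.NumberTheory.LFunctions Literature.NumberTheory.LFunctions.WeilContinuous

variable {T g : ℝ → ℂ} {E Ec κ x₁ : ℝ} {e Ve : ℝ → ℝ}

/-- **D6′ for a compactly supported (not necessarily smooth) odd tail.** As `norm_weilPrimeTerm_le_of_oddTail_cell`, with the Weil-test
hypothesis replaced by `g(u) = 0` for `|u| > a`: if `Σ_{n<K} Λ(n)/n^{m+1} ≤ S₁` and `Σ_{n<K} Λ(n)/√n·Ve(log n + 2x₁) ≤ X` for every `K`,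
then `‖weilPrimeTerm (g ⋆ g̃)‖ ≤ (2E²/(m+½))·S₁ + 2E_c²·X`. [THETA-CERT-cc6 §D6/§E4; TIER2-KERNEL-SPEC §2/§5; weil-1's proof verbatim] -/
theorem norm_weilPrimeTerm_le_of_oddTail_cell_of_radius {m : ℕ} (hx₁ : x₁ < 0) (hE : 0 ≤ E) (hEc : 0 ≤ Ec)
    (hT0 : ∀ u, x₁ < u → T u = 0)
    (hTE : ∀ u, u ≤ x₁ → ‖T u‖ ≤ E * Real.exp (((m : ℝ) + 1 / 2) * (u - x₁)))
    (hec : Continuous e) (he0 : ∀ s, 0 ≤ e s) (hTe : ∀ s, 0 ≤ s → ‖T (x₁ - s)‖ ≤ Ec * e s)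
    (hVe0 : ∀ w, 0 ≤ Ve w) (hVe : ∀ w, 0 ≤ w → ∫ s in (0 : ℝ)..w, e s * e (w - s) ≤ Ve w)
    {a : ℝ} (hga : ∀ u : ℝ, a < |u| → g u = 0) (hg : ∀ u, g u = T u - T (-u))
    {S₁ X : ℝ}
    (hS₁ : ∀ K : ℕ, ∑ n ∈ Finset.range K, (ArithmeticFunction.vonMangoldt n : ℝ) / (n : ℝ) ^ (m + 1) ≤ S₁)
    (hX : ∀ K : ℕ, ∑ n ∈ Finset.range K, (ArithmeticFunction.vonMangoldt n : ℝ) / Real.sqrt n *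
      Ve (Real.log n + 2 * x₁) ≤ X) :
    ‖weilPrimeTerm (weilConv g (weilReflect g))‖ ≤ 2 * E ^ 2 / ((m : ℝ) + 1 / 2) * S₁ + 2 * Ec ^ 2 * X := by
  set k : ℝ → ℂ := weilConv g (weilReflect g) with hk
  set κ : ℝ := (m : ℝ) + 1 / 2 with hκ
  have hκ0 : 0 < κ := by rw [hκ]; positivity
  have hkz : ∀ u : ℝ, 2 * a < |u| → k u = 0 := fun u hu ↦
    ThetaMellin.weilConv_weilReflect_eq_zero_of_radius hga hu
  rw [WeilContinuous.weilPrimeTerm_eq_sum_of_support hkz]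
  set K : ℕ := ⌈Real.exp (2 * a + 1)⌉₊ with hK
  have hterm : ∀ n ∈ Finset.range K,
      ‖((ArithmeticFunction.vonMangoldt n : ℝ) : ℂ) / (Real.sqrt n : ℂ) * (k (Real.log n) + k (-Real.log n))‖ ≤
        2 * E ^ 2 / κ * ((ArithmeticFunction.vonMangoldt n : ℝ) / (n : ℝ) ^ (m + 1)) +
          2 * Ec ^ 2 * ((ArithmeticFunction.vonMangoldt n : ℝ) / Real.sqrt n * Ve (Real.log n + 2 * x₁)) := by
    intro n _
    rcases Nat.eq_zero_or_pos n with h0 | hn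
    · subst h0; simp
    have hn1 : 1 ≤ n := hn
    have hΛ : 0 ≤ (ArithmeticFunction.vonMangoldt n : ℝ) := ArithmeticFunction.vonMangoldt_nonneg
    have hlog : 0 ≤ Real.log n := Real.log_natCast_nonneg n
    have hkb := norm_weilConv_weilReflect_oddTail_le_cell hx₁ hκ0 hE hEc hT0 (by simpa [hκ] using hTE) hec he0 hTe hVe0 hVe
      hg hlog
    have h2 := norm_weilConv_weilReflect_add_neg_le g (Real.log n)
    have hw := (weights_at_log (m := m) hn1 x₁).1
    rw [norm_mul, norm_div, Complex.norm_real, Complex.norm_real, Real.norm_of_nonneg hΛ,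
      Real.norm_of_nonneg (Real.sqrt_nonneg _)]
    have hsq0 : 0 < Real.sqrt n := Real.sqrt_pos.2 (by exact_mod_cast hn)
    calc (ArithmeticFunction.vonMangoldt n : ℝ) / Real.sqrt n * ‖k (Real.log n) + k (-Real.log n)‖
        ≤ (ArithmeticFunction.vonMangoldt n : ℝ) / Real.sqrt n *
            (2 * (E ^ 2 * Real.exp (-κ * Real.log n) / κ + Ec ^ 2 * Ve (Real.log n + 2 * x₁))) :=
          mul_le_mul_of_nonneg_left (h2.trans (by linarith [hkb])) (div_nonneg hΛ hsq0.le)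
      _ = 2 * E ^ 2 / κ * ((ArithmeticFunction.vonMangoldt n : ℝ) *
              ((1 / Real.sqrt n) * Real.exp (-κ * Real.log n))) +
            2 * Ec ^ 2 * ((ArithmeticFunction.vonMangoldt n : ℝ) / Real.sqrt n * Ve (Real.log n + 2 * x₁)) := by
          field_simp
      _ = _ := by rw [hκ, hw]; ring
  refine (norm_sum_le _ _).trans ((Finset.sum_le_sum hterm).trans ?_)
  rw [Finset.sum_add_distrib, ← Finset.mul_sum, ← Finset.mul_sum]
  have hE2 : 0 ≤ 2 * E ^ 2 / κ := by positivity
  have hE3 : 0 ≤ 2 * Ec ^ 2 := by positivity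
  exact add_le_add (mul_le_mul_of_nonneg_left (hS₁ K) hE2) (mul_le_mul_of_nonneg_left (hX K) hE3)

end Summit.RiemannHypothesis.RiemannHypothesis.Theorems.WeilColumn.ThetaPrime

end
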